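import Summits.AtomisticToContinuum.HydrodynamicLimit.Theorems.AntiMazurCoboundariesCorrectorPressureDecayKiferUniformGibbsGlueCore
import Summits.AtomisticToContinuum.HydrodynamicLimit.Theorems.AntiMazurCoboundariesCorrectorPressureDecayKiferCanonicalCellTuple
import Summits.AtomisticToContinuum.HydrodynamicLimit.Theorems.AntiMazurCoboundariesCorrectorPressureDecayKiferCollarTrick
import Summits.AtomisticToContinuum.HydrodynamicLimit.Theorems.AntiMazurCoboundariesCorrectorPressureDecayKiferFreeBoxExactCountHolds
import Summits.AtomisticToContinuum.HydrodynamicLimit.Theorems.AntiMazurCoboundariesCorrectorPressureDecayKiferFreeBoxMeanCount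
import Summits.AtomisticToContinuum.HydrodynamicLimit.Theorems.AntiMazurCoboundariesCorrectorPressureDecayKiferKLConditioning
import Summits.AtomisticToContinuum.HydrodynamicLimit.Theorems.AntiMazurCoboundariesCorrectorPressureDecayKiferGibbsReferenceSwap
import Mathlib.Order.Interval.Finset.Fin

/-!
# The thermodynamic step (B) of the Gibbs route (line `FirstLemma`, crux stmt-AtomisticToContinuum-14135)

Helper file of the registered stub `stub_tangentEntropyBoundUniformGibbs : TangentEntropyBoundUniformGibbs` (Gibbs route of
lead seat c9), namespace `Summit.AtomisticToContinuum.HydrodynamicLimit.Theorems.KiferCompactification`. It proves the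
registered sub-goal `canonicalBlockFreeEntropy_holds : CanonicalBlockFreeEntropy` (statement in `…KiferUniformGibbsPieces.lean`):
if SOME translation-invariant DLR state `G` of the unit-diameter hard-sphere gas at activity `0 < z ≤ 1/64` has density `σ³`
(`0 < σ ≤ 1/2`), then for every `δ > 0` there is `L₀` such that for `L ≥ L₀` and sizes `N k → ∞`, eventually in `k` the block
constant `c_{N k}(m_k)` of the cell inequality with `m_k := ⌊S_k / L⌋₊` cells per side (`S_k = ε_{N k}⁻¹` the side of the
blown-up torus) is at most `m_k³ · δ · L³`.

**Proof (assembly).** Write `γ_Λ := gibbsSpecMeasure 1 z θ⁻¹ u₀ Λ ∅` for the free cell measures, `E` for the torus hard core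
with total number `N k + 1` (`c9TorusHardCoreTuples`) and `L' := S_k / m_k ∈ [L, 2L]` for the actual cell side (eventually
`S_k ≥ 2L`, as `ε_{N k} → 0⁺`).
* IDENTIFICATION. By `c9_map_cellTuple_canonicalBlowUp_eq_cond` (…KiferCanonicalCellTuple) the cell-tuple law of the blown-up
  canonical law is `(⊗_j γ_{cell j})[|E]`, so `c_{N k}(m_k) = KL((⊗γ)[|E] ‖ ⊗γ) = -log (⊗γ)(E)` (`klDiv_cond_self`,
  …KiferKLConditioning).
* COLLAR TRICK (`c9_pi_free_torusHardCoreTuples_ge`, …KiferCollarTrick). For counts `k_j ∈ {q, q+1}` summing to `N k + 1`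
  (`blockFE_exists_cellCounts`), `(⊗γ)(E) ≥ ∏_j e^{-z vol(cell_j ∖ core_j)} · γ_{core_j}{# = k_j}`, the cores being the boxes
  of side `L' - 2` at distance `1` from the cell faces; `vol(cell ∖ core) ≤ 6 L'²` (`blockFE_volume_c9Cell_diff_core_le`).
* EXACT COUNT (`c9_free_box_count_ge_exp_neg`, …KiferFreeBoxExactCountHolds, with `η := δ/16`). Since `N k + 1 = σ³ S_k³`
  exactly, `(N k + 1)/m_k³ = σ³ L'³` and `|k_j - σ³ (L'-2)³| ≤ 1 + σ³ (L'³ - (L'-2)³) ≤ 2 (L'-2)² + 10`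
  (`blockFE_abs_sub_mul_sub_two_pow_le`, using `σ³ ≤ 1/8`, `L' ≥ 4`), so `γ_{core_j}{# = k_j} ≥ e^{-η (L'-2)³}` once
  `L' - 2 ≥ ℓ₀(η)`.
* ARITHMETIC. Hence `-log (⊗γ)(E) ≤ m_k³ (6 z L'² + η (L'-2)³) ≤ m_k³ δ L³` for `L ≥ 48 z/δ + 4` (`blockFE_blockCost_le`).

No named fact is used; the inputs are the tree theorems quoted above.
-/

noncomputable section

open MeasureTheory ProbabilityTheory Set Filter Topology InformationTheory
open scoped ENNReal NNReal

namespace Summit.AtomisticToContinuum.HydrodynamicLimit.Theorems.KiferCompactification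

open Literature.MathematicalPhysics.KineticTheory (T3 V3 hsDiameter hsDiameter_pos succ_mul_hsDiameter_pow_three localGibbsLaw
  blowUp)
open Literature.MathematicalPhysics.KineticTheory.HardSphereDLR (gibbsSpecMeasure)
open Literature.MathematicalPhysics.KineticTheory.PointProcess (windowRestrict density)
open Literature.Analysis.FluidPDE (HardSphereFlow IsHardSphereGibbs IsTranslationInvariant)
open Literature.Analysis.FunctionSpaces (PointConfig)

/-! ## The collar of a cell is thin -/

/-- The core of a cell is a closed box of side `S/m - 2`. -/
theorem blockFE_c9CellCore_eq_c9Box (S : ℝ) (m : ℕ) (j : Fin 3 → Fin m) :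
    c9CellCore S m j = c9Box (WithLp.toLp 2 fun i => -S / 2 + ((j i : ℕ) : ℝ) * (S / m) + 1) (S / m - 2) := by
  ext y
  simp only [c9CellCore, c9Box, Set.mem_setOf_eq]
  refine forall_congr' fun i => ?_
  rw [show -S / 2 + ((j i : ℕ) : ℝ) * (S / m) + 1 + (S / m - 2) = -S / 2 + (((j i : ℕ) : ℝ) + 1) * (S / m) - 1 by ring]

/-- **The collar is thin**: `vol(cell ∖ core) ≤ 6 (S/m)²` when `S/m ≥ 2` (the cell is an `Ioc` coordinate box of side `S/m`,
`freeBox_volume_coordBox`; the core is the closed box of side `S/m - 2`, `freeBox_volume`). -/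
theorem blockFE_volume_c9Cell_diff_core_le (S : ℝ) (m : ℕ) (hSm : 2 ≤ S / m) (j : Fin 3 → Fin m) :
    volume (c9Cell S m j \ c9CellCore S m j) ≤ ENNReal.ofReal (6 * (S / m) ^ 2) := by
  have hS : 0 ≤ S := by
    have hm0 : (0 : ℝ) ≤ m := Nat.cast_nonneg _
    rcases eq_or_lt_of_le hm0 with hm | hm
    · -- `m = 0`: `S / 0 = 0`, contradicting `2 ≤ S / m`
      rw [← hm, div_zero] at hSm; linarith
    · have := (le_div_iff₀ hm).1 hSm; nlinarith
  have hSm0 : 0 ≤ S / m := div_nonneg hS (Nat.cast_nonneg _)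
  have h0 : 0 ≤ S / m - 2 := by linarith
  -- the volume of the cell
  have hcell : volume (c9Cell S m j) = ENNReal.ofReal (S / m) ^ 3 := by
    have h := freeBox_volume_coordBox
      (s := fun i => Ioc (-S / 2 + ((j i : ℕ) : ℝ) * (S / m)) (-S / 2 + (((j i : ℕ) : ℝ) + 1) * (S / m))) fun i => measurableSet_Ioc
    have hterm : ∀ i : Fin 3, volume (Ioc (-S / 2 + ((j i : ℕ) : ℝ) * (S / m)) (-S / 2 + (((j i : ℕ) : ℝ) + 1) * (S / m))) =
        ENNReal.ofReal (S / m) := fun i => by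
      rw [Real.volume_Ioc]; congr 1; ring
    rw [show c9Cell S m j = {y : V3 | ∀ i, y i ∈ Ioc (-S / 2 + ((j i : ℕ) : ℝ) * (S / m)) (-S / 2 + (((j i : ℕ) : ℝ) + 1) * (S / m))}
      from rfl, h, Finset.prod_congr rfl fun i _ => hterm i, Finset.prod_const, Finset.card_univ, Fintype.card_fin]
  -- the volume of the core
  have hcore : volume (c9CellCore S m j) = ENNReal.ofReal (S / m - 2) ^ 3 := by
    rw [blockFE_c9CellCore_eq_c9Box, freeBox_volume]
  rw [measure_sdiff (c9CellCore_subset_c9Cell S m j) (measurableSet_c9CellCore S m j).nullMeasurableSet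
    (by rw [hcore]; exact ENNReal.pow_ne_top ENNReal.ofReal_ne_top), hcell, hcore, ← ENNReal.ofReal_pow hSm0,
    ← ENNReal.ofReal_pow h0, ← ENNReal.ofReal_sub _ (by positivity)]
  refine ENNReal.ofReal_le_ofReal ?_
  nlinarith

/-! ## Sizes -/

/-- `N + 1 = σ³ S³` with `S = ε_N⁻¹`. -/
theorem blockFE_succ_eq_cube_mul_inv_hsDiameter_pow {σ : ℝ} (hσ : 0 < σ) (N : ℕ) :
    ((N + 1 : ℕ) : ℝ) = σ ^ 3 * ((hsDiameter σ N)⁻¹) ^ 3 := by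
  have hε := hsDiameter_pos hσ N
  have h := succ_mul_hsDiameter_pow_three σ N
  field_simp
  linarith [h]

/-! ## Prescribed cell counts -/

/-- Integers `k_j ∈ {q, q+1}`, `q = n / m³`, summing to `n` over the `m³` cells. -/
theorem blockFE_exists_cellCounts (m n : ℕ) (hm : 0 < m) :
    ∃ k : (Fin 3 → Fin m) → ℕ, (∑ j, k j = n) ∧ ∀ j, k j = n / m ^ 3 ∨ k j = n / m ^ 3 + 1 := by
  classical
  have hMeq : Fintype.card (Fin 3 → Fin m) = m ^ 3 := by rw [Fintype.card_fun, Fintype.card_fin, Fintype.card_fin]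
  have hM0 : 0 < m ^ 3 := by positivity
  obtain ⟨e⟩ : Nonempty ((Fin 3 → Fin m) ≃ Fin (m ^ 3)) := by rw [← hMeq]; exact ⟨Fintype.equivFin _⟩
  refine ⟨fun j => n / m ^ 3 + if (e j : ℕ) < n % m ^ 3 then 1 else 0, ?_, fun j => ?_⟩
  · rw [Finset.sum_add_distrib, Finset.sum_const, Finset.card_univ, hMeq, smul_eq_mul]
    have hcount : (∑ j : Fin 3 → Fin m, if (e j : ℕ) < n % m ^ 3 then 1 else 0) = n % m ^ 3 := by
      rw [← Equiv.sum_comp e.symm fun j => if (e j : ℕ) < n % m ^ 3 then (1 : ℕ) else 0]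
      simp only [Equiv.apply_symm_apply, Finset.sum_boole, Nat.cast_id]
      have hrM : n % m ^ 3 < m ^ 3 := Nat.mod_lt _ hM0
      have : (Finset.univ.filter fun i : Fin (m ^ 3) => (i : ℕ) < n % m ^ 3) = Finset.Iio (⟨n % m ^ 3, hrM⟩ : Fin (m ^ 3)) := by
        ext i; simp [Fin.lt_def]
      rw [this, Fin.card_Iio]
    rw [hcount]
    exact Nat.div_add_mod n (m ^ 3)
  · by_cases h : (e j : ℕ) < n % m ^ 3
    · right; simp [h]
    · left; simp [h]

/-- `q = n / M` in `ℕ` is within `1` of `n / M` in `ℝ`. -/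
theorem blockFE_abs_natDiv_sub_div_le (n M : ℕ) (hM : 0 < M) (k : ℕ) (hk : k = n / M ∨ k = n / M + 1) :
    |(k : ℝ) - (n : ℝ) / M| ≤ 1 := by
  have hM' : (0 : ℝ) < M := by exact_mod_cast hM
  have h1 : ((n / M : ℕ) : ℝ) ≤ (n : ℝ) / M := Nat.cast_div_le
  have h2 : (n : ℝ) / M < (n / M : ℕ) + 1 := by
    rw [div_lt_iff₀ hM']
    have := Nat.lt_div_mul_add (a := n) hM
    calc (n : ℝ) < ((n / M * M + M : ℕ) : ℝ) := by exact_mod_cast this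
      _ = ((n / M : ℕ) + 1) * M := by push_cast; ring
  rcases hk with rfl | rfl
  · rw [abs_le]; constructor <;> linarith
  · rw [abs_le]; push_cast; constructor <;> linarith

/-! ## Arithmetic of the assembly -/

/-- Window arithmetic for the exact count in a core: if `|k - s L³| ≤ 1` with `0 ≤ s ≤ 1/8` and `L ≥ 4`, then
`|k - s (L-2)³| ≤ 2 (L-2)² + 10`. -/
theorem blockFE_abs_sub_mul_sub_two_pow_le {s L k : ℝ} (hs0 : 0 ≤ s) (hs : s ≤ 1 / 8) (hL : 4 ≤ L) (hk : |k - s * L ^ 3| ≤ 1) :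
    |k - s * (L - 2) ^ 3| ≤ 2 * (L - 2) ^ 2 + 10 := by
  have hX : 0 ≤ 6 * L ^ 2 - 12 * L + 8 := by nlinarith [sq_nonneg (L - 1)]
  have h1 : |k - s * (L - 2) ^ 3| ≤ |k - s * L ^ 3| + s * (6 * L ^ 2 - 12 * L + 8) := by
    calc |k - s * (L - 2) ^ 3| = |(k - s * L ^ 3) + s * (6 * L ^ 2 - 12 * L + 8)| := by ring_nf
      _ ≤ |k - s * L ^ 3| + |s * (6 * L ^ 2 - 12 * L + 8)| := abs_add_le _ _
      _ = |k - s * L ^ 3| + s * (6 * L ^ 2 - 12 * L + 8) := by rw [abs_of_nonneg (mul_nonneg hs0 hX)]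
  have h2 : s * (6 * L ^ 2 - 12 * L + 8) ≤ 1 + 3 / 4 * L ^ 2 := by
    have h := mul_le_mul_of_nonneg_right hs hX
    have hL0 : 0 ≤ L := by linarith
    linarith
  have h3 : 3 / 4 * L ^ 2 + 2 ≤ 2 * (L - 2) ^ 2 + 10 := by nlinarith [sq_nonneg (L - 16 / 5)]
  linarith

/-- Sizes: for `0 < L` and `2L ≤ S`, `m := ⌊S/L⌋₊ ≥ 2` and `L ≤ S/m ≤ 2L`. -/
theorem blockFE_two_le_floor_div_and {S L : ℝ} (hL : 0 < L) (hS : 2 * L ≤ S) :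
    2 ≤ ⌊S / L⌋₊ ∧ L ≤ S / ⌊S / L⌋₊ ∧ S / ⌊S / L⌋₊ ≤ 2 * L := by
  have hSL2 : (2 : ℝ) ≤ S / L := by rw [le_div_iff₀ hL]; linarith
  have hm2 : 2 ≤ ⌊S / L⌋₊ := Nat.le_floor (by exact_mod_cast hSL2)
  have hm2R : (2 : ℝ) ≤ ⌊S / L⌋₊ := by exact_mod_cast hm2
  have hmR : (0 : ℝ) < ⌊S / L⌋₊ := by linarith
  have hmle : (⌊S / L⌋₊ : ℝ) ≤ S / L := Nat.floor_le (by positivity)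
  have hmgt : S / L < ⌊S / L⌋₊ + 1 := Nat.lt_floor_add_one (S / L)
  refine ⟨hm2, ?_, ?_⟩
  · rw [le_div_iff₀ hmR]
    calc L * ⌊S / L⌋₊ ≤ L * (S / L) := by gcongr
      _ = S := by field_simp
  · rw [div_le_iff₀ hmR]
    rw [div_lt_iff₀ hL] at hmgt
    nlinarith [mul_nonneg hL.le (sub_nonneg.2 hm2R)]

/-- The cost per cell is small: `6 z L'² + (δ/16) (L'-2)³ ≤ δ L³` for `L ≤ L' ≤ 2L` and `L ≥ 48 z/δ + 4`. -/
theorem blockFE_blockCost_le {z δ L L' : ℝ} (hz : 0 ≤ z) (hδ : 0 < δ) (hL : 48 * z / δ + 4 ≤ L) (hLL' : L ≤ L')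
    (hL'2 : L' ≤ 2 * L) :
    6 * z * L' ^ 2 + δ / 16 * (L' - 2) ^ 3 ≤ δ * L ^ 3 := by
  have hzd : 0 ≤ 48 * z / δ := by positivity
  have hL0 : 0 < L := by linarith
  have hzL : 48 * z ≤ L * δ := (div_le_iff₀ hδ).1 (by linarith)
  have h1 : 6 * z * L' ^ 2 ≤ δ * L ^ 3 / 2 := by
    have hL'sq : L' ^ 2 ≤ 4 * L ^ 2 := by nlinarith
    calc 6 * z * L' ^ 2 ≤ 6 * z * (4 * L ^ 2) := by gcongr
      _ = 48 * z * L ^ 2 / 2 := by ring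
      _ ≤ L * δ * L ^ 2 / 2 := by gcongr
      _ = δ * L ^ 3 / 2 := by ring
  have h2 : δ / 16 * (L' - 2) ^ 3 ≤ δ * L ^ 3 / 2 := by
    have h0 : 0 ≤ L' - 2 := by linarith
    have h3 : (L' - 2) ^ 3 ≤ (2 * L) ^ 3 := by gcongr; linarith
    calc δ / 16 * (L' - 2) ^ 3 ≤ δ / 16 * (2 * L) ^ 3 := by gcongr
      _ = δ * L ^ 3 / 2 := by ring
  linarith

/-- `exp (-(M c)) = ∏_{j ∈ J} exp (-c)` in `ℝ≥0∞` when `|J| = M`. -/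
theorem blockFE_ofReal_exp_neg_mul_eq_prod (m : ℕ) (c : ℝ) :
    ENNReal.ofReal (Real.exp (-((m : ℝ) ^ 3 * c))) = ∏ _j : Fin 3 → Fin m, ENNReal.ofReal (Real.exp (-c)) := by
  rw [Finset.prod_const, Finset.card_univ, Fintype.card_fun, Fintype.card_fin, Fintype.card_fin,
    ← ENNReal.ofReal_pow (Real.exp_pos _).le, ← Real.exp_nat_mul]
  congr 2
  push_cast
  ring

/-! ## The lower bound on the product measure of the torus-hard-core tuples -/

/-- **The product of the free cell measures charges the torus-hard-core tuples with total number `n = s S³` at least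
`exp (-m³ (6 z L'² + η (L'-2)³))`**, `L' = S/m ≥ 4`, provided every free box of side `ℓ ≥ ℓ₀` gives the counts within
`2ℓ² + 10` of `s ℓ³` probability `≥ exp (-η ℓ³)` and `L' - 2 ≥ ℓ₀`: the collar trick `c9_pi_free_torusHardCoreTuples_ge` with the
counts `k_j ∈ {q, q+1}` of `blockFE_exists_cellCounts`, the thin collar `blockFE_volume_c9Cell_diff_core_le` and the exact count in each core
(a box of side `L' - 2`, `blockFE_c9CellCore_eq_c9Box`; the window arithmetic is `blockFE_abs_sub_mul_sub_two_pow_le`). -/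
theorem blockFE_exp_neg_le_pi_c9TorusHardCoreTuples {z β : ℝ} {u : V3} (hz : 0 < z) (hβ : 0 < β) {S : ℝ} (hS : 0 < S) {m : ℕ}
    (hm : 2 ≤ m) {n : ℕ} {s η ℓ₀ : ℝ} (hs0 : 0 ≤ s) (hs : s ≤ 1 / 8) (hn : (n : ℝ) = s * S ^ 3) (h4 : 4 ≤ S / m)
    (hℓ : ℓ₀ ≤ S / m - 2)
    (hcnt : ∀ (a : V3) (ℓ : ℝ), ℓ₀ ≤ ℓ → ∀ k : ℕ, |(k : ℝ) - s * ℓ ^ 3| ≤ 2 * ℓ ^ 2 + 10 →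
      ENNReal.ofReal (Real.exp (-(η * ℓ ^ 3))) ≤ gibbsSpecMeasure 1 z β u (c9Box a ℓ) ∅ {ω | ω.count univ = k}) :
    ENNReal.ofReal (Real.exp (-((m : ℝ) ^ 3 * (6 * z * (S / m) ^ 2 + η * (S / m - 2) ^ 3)))) ≤
      (Measure.pi fun j : Fin 3 → Fin m => gibbsSpecMeasure 1 z β u (c9Cell S m j) ∅) (c9TorusHardCoreTuples S m n) := by
  classical
  have hm0 : 0 < m := by omega
  have hmR : (0 : ℝ) < m := by exact_mod_cast hm0
  have hSm : 2 ≤ S / m := by linarith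
  obtain ⟨kk, hksum, hkq⟩ := blockFE_exists_cellCounts m n hm0
  refine le_trans ?_ (c9_pi_free_torusHardCoreTuples_ge hz.le hβ hS hm n kk hksum)
  rw [blockFE_ofReal_exp_neg_mul_eq_prod]
  refine Finset.prod_le_prod' fun j _ => ?_
  -- the collar of the cell `j`
  have hvol : (volume (c9Cell S m j \ c9CellCore S m j)).toReal ≤ 6 * (S / m) ^ 2 := by
    have h := ENNReal.toReal_mono ENNReal.ofReal_ne_top (blockFE_volume_c9Cell_diff_core_le S m hSm j)
    rwa [ENNReal.toReal_ofReal (by positivity)] at h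
  have h1 : ENNReal.ofReal (Real.exp (-(6 * z * (S / m) ^ 2))) ≤
      ENNReal.ofReal (Real.exp (-(z * (volume (c9Cell S m j \ c9CellCore S m j)).toReal))) := by
    refine ENNReal.ofReal_le_ofReal (Real.exp_le_exp.2 (neg_le_neg ?_))
    calc z * (volume (c9Cell S m j \ c9CellCore S m j)).toReal ≤ z * (6 * (S / m) ^ 2) := by gcongr
      _ = 6 * z * (S / m) ^ 2 := by ring
  -- the exact count in the core of the cell `j`
  have hwin : |((kk j : ℕ) : ℝ) - s * (S / m - 2) ^ 3| ≤ 2 * (S / m - 2) ^ 2 + 10 := by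
    refine blockFE_abs_sub_mul_sub_two_pow_le hs0 hs h4 ?_
    have hq := blockFE_abs_natDiv_sub_div_le n (m ^ 3) (by positivity) (kk j) (hkq j)
    have hdiv : (n : ℝ) / ((m ^ 3 : ℕ) : ℝ) = s * (S / m) ^ 3 := by
      rw [hn]; push_cast; field_simp
    rwa [hdiv] at hq
  have h2 := hcnt (WithLp.toLp 2 fun i => -S / 2 + ((j i : ℕ) : ℝ) * (S / m) + 1) (S / m - 2) hℓ (kk j) hwin
  rw [← blockFE_c9CellCore_eq_c9Box] at h2
  -- combine
  calc ENNReal.ofReal (Real.exp (-(6 * z * (S / m) ^ 2 + η * (S / m - 2) ^ 3)))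
      = ENNReal.ofReal (Real.exp (-(6 * z * (S / m) ^ 2))) * ENNReal.ofReal (Real.exp (-(η * (S / m - 2) ^ 3))) := by
        rw [← ENNReal.ofReal_mul (Real.exp_pos _).le, ← Real.exp_add, neg_add]
    _ ≤ _ := mul_le_mul' h1 h2

/-! ## The assembly -/

/-- **THE THERMODYNAMIC STEP (B) OF THE GIBBS ROUTE HOLDS** (registered sub-goal `canonicalBlockFreeEntropy_holds` of line
`FirstLemma`): if some translation-invariant `G ∈ Gibbs(z)`, `0 < z ≤ 1/64`, has density `σ³`, then for every `δ > 0` there is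
`L₀ > 0` such that for all `L ≥ L₀` and sizes `N k → ∞`, eventually
`canonicalBlockConst … (N k) (Φ k) ⌊S_k/L⌋₊ ≤ ⌊S_k/L⌋₊³ · δ · L³`. Identification + `klDiv_cond_self`, then the lower bound
`blockFE_exp_neg_le_pi_c9TorusHardCoreTuples` (collar trick and exact count) and the arithmetic `blockFE_blockCost_le` (see the
module docstring). -/
theorem canonicalBlockFreeEntropy_holds : CanonicalBlockFreeEntropy := by
  intro σ a θ u₀ z hσ hσ2 ha hθ hz hz64 hG δ hδ
  obtain ⟨G, hG, hGT, hGd⟩ := hG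
  have hβ : 0 < θ⁻¹ := inv_pos.2 hθ
  have hσ30 : 0 ≤ σ ^ 3 := by positivity
  have hσ3 : σ ^ 3 ≤ 1 / 8 := by
    calc σ ^ 3 ≤ (1 / 2) ^ 3 := by gcongr
      _ = 1 / 8 := by norm_num
  have hρ : (density G).toReal = σ ^ 3 := by rw [hGd, ENNReal.toReal_ofReal hσ30]
  obtain ⟨ℓ₀, hℓ₀, hcnt⟩ := c9_free_box_count_ge_exp_neg hz hz64 hβ hG hGT (η := δ / 16) (by positivity)
  rw [hρ] at hcnt
  refine ⟨max (ℓ₀ + 2) (48 * z / δ + 4), lt_max_of_lt_left (by linarith), fun L hL N Φ hN => ?_⟩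
  have hLℓ : ℓ₀ + 2 ≤ L := (le_max_left _ _).trans hL
  have hLz : 48 * z / δ + 4 ≤ L := (le_max_right _ _).trans hL
  have hzd : 0 ≤ 48 * z / δ := by positivity
  have hL0 : 0 < L := by linarith
  -- eventually the blown-up torus is large: `S_k ≥ 2L`
  have hSinf : Tendsto (fun k => (hsDiameter σ (N k))⁻¹) atTop atTop := by
    refine Filter.Tendsto.inv_tendsto_nhdsGT_zero ?_
    exact tendsto_nhdsWithin_of_tendsto_nhds_of_eventually_within _ (tendsto_hsDiameter_of_tendsto hN)
      (Eventually.of_forall fun k => hsDiameter_pos hσ (N k))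
  filter_upwards [hSinf.eventually_ge_atTop (2 * L)] with k hk
  have hnS : ((N k + 1 : ℕ) : ℝ) = σ ^ 3 * ((hsDiameter σ (N k))⁻¹) ^ 3 := blockFE_succ_eq_cube_mul_inv_hsDiameter_pow hσ (N k)
  have hS0 : 0 < (hsDiameter σ (N k))⁻¹ := inv_pos.2 (hsDiameter_pos hσ (N k))
  obtain ⟨hm2, hLL', hL'2⟩ := blockFE_two_le_floor_div_and hL0 hk
  have hm0 : 0 < ⌊(hsDiameter σ (N k))⁻¹ / L⌋₊ := by omega
  -- the identification of the block constant (base point `0`)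
  rw [canonicalBlockConst, c9_map_cellTuple_canonicalBlowUp_eq_cond σ a θ u₀ hσ hσ2 ha hθ hz (N k) (Φ k) 0 hm0]
  generalize (hsDiameter σ (N k))⁻¹ = S at hk hnS hS0 hm2 hLL' hL'2 hm0 ⊢
  generalize ⌊S / L⌋₊ = m at hm2 hLL' hL'2 hm0 ⊢
  -- the lower bound on the product measure of the event
  have h4 : 4 ≤ S / m := by linarith
  have hℓ : ℓ₀ ≤ S / m - 2 := by linarith
  have hprod := blockFE_exp_neg_le_pi_c9TorusHardCoreTuples (η := δ / 16) hz hβ hS0 hm2 hσ30 hσ3 hnS h4 hℓ hcnt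
  haveI : ∀ j : Fin 3 → Fin m, IsProbabilityMeasure (gibbsSpecMeasure 1 z θ⁻¹ u₀ (c9Cell S m j) ∅) := fun j =>
    isProbabilityMeasure_gibbsSpecMeasure_empty hz.le hβ u₀ (measurableSet_c9Cell S m j) (isBounded_c9Cell S m j).measure_lt_top.ne
  have hEpos : (Measure.pi fun j : Fin 3 → Fin m => gibbsSpecMeasure 1 z θ⁻¹ u₀ (c9Cell S m j) ∅)
      (c9TorusHardCoreTuples S m (N k + 1)) ≠ 0 :=
    ((ENNReal.ofReal_pos.2 (Real.exp_pos _)).trans_le hprod).ne'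
  rw [klDiv_cond_self _ (measurableSet_c9TorusHardCoreTuples S m (N k + 1)) hEpos]
  refine ENNReal.ofReal_le_ofReal ?_
  have hreal : Real.exp (-((m : ℝ) ^ 3 * (6 * z * (S / m) ^ 2 + δ / 16 * (S / m - 2) ^ 3))) ≤
      (Measure.pi fun j : Fin 3 → Fin m => gibbsSpecMeasure 1 z θ⁻¹ u₀ (c9Cell S m j) ∅).real
        (c9TorusHardCoreTuples S m (N k + 1)) := by
    have h := ENNReal.toReal_mono (measure_ne_top _ _) hprod
    rwa [ENNReal.toReal_ofReal (Real.exp_pos _).le] at h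
  have hlog := Real.log_le_log (Real.exp_pos _) hreal
  rw [Real.log_exp] at hlog
  have hc := blockFE_blockCost_le hz.le hδ hLz hLL' hL'2
  have hm3 : (0 : ℝ) ≤ (m : ℝ) ^ 3 := by positivity
  nlinarith [mul_le_mul_of_nonneg_left hc hm3]

end Summit.AtomisticToContinuum.HydrodynamicLimit.Theorems.KiferCompactification

end
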